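import Literature.Probability.RandomPlanarGeometry.ObliqueRBMWedgeConformal
import Literature.Probability.RandomPlanarGeometry.ObliqueRBMWedgeBoundary
import Mathlib.Probability.CDF
import Mathlib.MeasureTheory.Integral.Layercake
import Mathlib.MeasureTheory.Integral.Prod
import HarnessLib

/-!
# Identification of the uniform law from the test identities

Layer of the proof of
`Literature.Probability.RandomPlanarGeometry.LawlerSchrammWerner2001_orbm_uniformHitting`
(`ObliqueRBMWedge.lean`). Pure measure theory on `[0, 1]`: let `S` be a `[0,1]`-valued random
variable on a probability space such that

* for every pair of test intervals `D` (test density `m = 𝟙_{(α,β)}/(β−α) − 𝟙_{(γ,δ)}/(δ−γ)`),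
  `∫₀¹ π ρ̃(y) m(y) P(scRatio y < S) dy = ∫₀¹ π ρ̃(y) m(y) (1 − scRatio y) dy`
  (this is what the harmonic test functions give, `ObliqueRBMWedgeApex`), and
* `E[S] = 1/2` (this is what the quadratic test function gives),

then the law of `S` is the uniform law on `[0,1]`. Steps: the averages of
`Λ(y) = ρ̃(y)(P(scRatio y < S) − 1 + scRatio y)` over all subintervals of `(0,1)` coincide; `Λ` is
right-continuous (distribution functions are), hence constant `= K` (right derivative of the
primitive); the layer-cake formula for `E[S]` forces `K = 0`; distribution functions then agree with
the uniform ones.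

## References

* Standard (Billingsley, *Probability and Measure*, §§12, 14). [folklore]
-/

noncomputable section

open Set Filter Topology MeasureTheory intervalIntegral Metric ProbabilityTheory
open scoped Real Interval

namespace Literature.Probability.RandomPlanarGeometry

open TestIntervals (rhoTilde rhoTilde_pos continuousOn_rhoTilde)

/-! ### The clamped beta ratio -/

/-- The beta ratio extended continuously to `ℝ` by clamping the argument to `[0, 1]`. [folklore] -/
def scRatioC (y : ℝ) : ℝ := scRatio (max 0 (min 1 y))

/-- Auxiliary statement (`scRatioC_eq`). [folklore] -/
theorem scRatioC_eq {y : ℝ} (hy : y ∈ Icc (0:ℝ) 1) : scRatioC y = scRatio y := by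
  rw [scRatioC, min_eq_right hy.2, max_eq_right hy.1]

/-- Auxiliary statement (`clamp01_mem`). [folklore] -/
theorem clamp01_mem (y : ℝ) : max 0 (min 1 y) ∈ Icc (0:ℝ) 1 :=
  ⟨le_max_left _ _, max_le zero_le_one (min_le_left _ _)⟩

/-- Auxiliary statement (`continuous_scRatioC`). [folklore] -/
theorem continuous_scRatioC : Continuous scRatioC := by
  have hc : Continuous fun y : ℝ ↦ max 0 (min 1 y) := by fun_prop
  exact continuousOn_scRatio.comp_continuous hc clamp01_mem

/-- Auxiliary statement (`measurable_scRatioC`). [folklore] -/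
theorem measurable_scRatioC : Measurable scRatioC := continuous_scRatioC.measurable

/-- Auxiliary statement (`scRatioC_mem`). [folklore] -/
theorem scRatioC_mem (y : ℝ) : scRatioC y ∈ Icc (0:ℝ) 1 := scRatio_mem_Icc (clamp01_mem y)

/-- Auxiliary statement (`monotone_scRatioC`). [folklore] -/
theorem monotone_scRatioC : Monotone scRatioC := by
  intro a b hab
  unfold scRatioC
  exact strictMonoOn_scRatio.monotoneOn (clamp01_mem a) (clamp01_mem b)
    (max_le_max le_rfl (min_le_min le_rfl hab))

/-- `y < scRatioInv s ↔ scRatio y < s` for `y, s ∈ [0, 1]`. [folklore] -/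
theorem lt_scRatioInv_iff {y s : ℝ} (hy : y ∈ Icc (0:ℝ) 1) (hs : s ∈ Icc (0:ℝ) 1) :
    y < scRatioInv s ↔ scRatio y < s := by
  have hm := scRatioInv_mem hs
  constructor
  · intro h
    have := strictMonoOn_scRatio hy hm h
    rwa [scRatio_scRatioInv hs] at this
  · intro h
    by_contra hle
    rw [not_lt] at hle
    have := strictMonoOn_scRatio.monotoneOn hm hy hle
    rw [scRatio_scRatioInv hs] at this
    linarith

/-! ### Distribution functions -/

section Survival

variable {Ω : Type*} [MeasurableSpace Ω] (P : Measure Ω) [IsProbabilityMeasure P] (S : Ω → ℝ)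

/-- The survival function `t ↦ P(t < S)`. [folklore] -/
def survT (t : ℝ) : ℝ := P.real {ω | t < S ω}

/-- The survival function in the `y`-parametrisation `y ↦ P(scRatio y < S)` (clamped). [folklore] -/
def survY (y : ℝ) : ℝ := survT P S (scRatioC y)

variable {P S}

/-- `survT t = 1 − cdf t`. [folklore] -/
theorem survT_eq (hS : Measurable S) (t : ℝ) : survT P S t = 1 - cdf (P.map S) t := by
  haveI : IsProbabilityMeasure (P.map S) := Measure.isProbabilityMeasure_map hS.aemeasurable
  rw [cdf_eq_real, map_measureReal_apply hS measurableSet_Iic, survT]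
  have hcompl : {ω | t < S ω} = (S ⁻¹' Iic t)ᶜ := by ext ω; simp [not_le]
  rw [hcompl, measureReal_compl (hS measurableSet_Iic), probReal_univ]

/-- The survival function is right-continuous. [folklore] -/
theorem continuousWithinAt_survT (hS : Measurable S) (t : ℝ) : ContinuousWithinAt (survT P S) (Ici t) t := by
  haveI : IsProbabilityMeasure (P.map S) := Measure.isProbabilityMeasure_map hS.aemeasurable
  have h := (cdf (P.map S)).right_continuous t
  have : survT P S = fun t ↦ 1 - cdf (P.map S) t := funext (survT_eq hS)
  rw [this]
  exact continuousWithinAt_const.sub h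

/-- The survival function is antitone. [folklore] -/
theorem antitone_survT (hS : Measurable S) : Antitone (survT P S) := by
  haveI : IsProbabilityMeasure (P.map S) := Measure.isProbabilityMeasure_map hS.aemeasurable
  intro a b hab
  rw [survT_eq hS, survT_eq hS]
  linarith [monotone_cdf (P.map S) hab]

/-- Auxiliary statement (`measurable_survT`). [folklore] -/
theorem measurable_survT (hS : Measurable S) : Measurable (survT P S) := (antitone_survT hS).measurable

omit [IsProbabilityMeasure P] in
/-- Auxiliary statement (`survT_nonneg`). [folklore] -/
theorem survT_nonneg (t : ℝ) : 0 ≤ survT P S t := measureReal_nonneg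

/-- Auxiliary statement (`survT_le_one`). [folklore] -/
theorem survT_le_one (t : ℝ) : survT P S t ≤ 1 := measureReal_le_one

/-- **`survY` is right-continuous** (composition of the right-continuous antitone `survT` with the
continuous monotone `scRatioC`). [folklore] -/
theorem continuousWithinAt_survY (hS : Measurable S) (y : ℝ) : ContinuousWithinAt (survY P S) (Ici y) y := by
  unfold survY
  have h1 : Tendsto scRatioC (𝓝[Ici y] y) (𝓝[Ici (scRatioC y)] (scRatioC y)) := by
    refine tendsto_nhdsWithin_iff.2 ⟨continuous_scRatioC.continuousWithinAt.tendsto, ?_⟩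
    filter_upwards [self_mem_nhdsWithin] with y' hy'
    exact monotone_scRatioC hy'
  exact (continuousWithinAt_survT hS (scRatioC y)).tendsto.comp h1

/-- Auxiliary statement (`measurable_survY`). [folklore] -/
theorem measurable_survY (hS : Measurable S) : Measurable (survY P S) := (measurable_survT hS).comp measurable_scRatioC

end Survival

/-! ### Elementary interval-integral facts -/

/-- The integral over `[0,1]` of an indicator of `(a, b) ⊆ [0,1]` times a function. [folklore] -/
theorem integral_indicator_Ioo_mul {a b : ℝ} (ha : 0 ≤ a) (hab : a ≤ b) (hb : b ≤ 1) (c : ℝ) (f : ℝ → ℝ) :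
    ∫ y in (0:ℝ)..1, (Ioo a b).indicator (fun _ ↦ c) y * f y = c * ∫ y in a..b, f y := by
  rw [intervalIntegral.integral_of_le zero_le_one, intervalIntegral.integral_of_le hab]
  have h1 : ∀ y, (Ioo a b).indicator (fun _ ↦ c) y * f y = (Ioo a b).indicator (fun y ↦ c * f y) y := by
    intro y; by_cases hy : y ∈ Ioo a b <;> simp [hy]
  simp_rw [h1]
  rw [MeasureTheory.integral_indicator measurableSet_Ioo, Measure.restrict_restrict measurableSet_Ioo,
    show Ioo a b ∩ Ioc 0 1 = Ioo a b from inter_eq_left.2 fun y hy ↦ ⟨ha.trans_lt hy.1, hy.2.le.trans hb⟩,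
    ← integral_Ioc_eq_integral_Ioo, MeasureTheory.integral_const_mul]

/-- A bounded measurable function is interval integrable. [folklore] -/
theorem intervalIntegrable_of_bounded {f : ℝ → ℝ} (hf : Measurable f) {C : ℝ} (hC : ∀ y, |f y| ≤ C) (a b : ℝ) :
    IntervalIntegrable f volume a b :=
  (intervalIntegrable_const (c := C)).mono_fun' hf.aestronglyMeasurable (ae_of_all _ fun y ↦ by
    show ‖f y‖ ≤ C
    rw [Real.norm_eq_abs]; exact hC y)

/-- A measurable function bounded on `Ι a b` is interval integrable. [folklore] -/
theorem intervalIntegrable_of_bounded_on {f : ℝ → ℝ} (hf : Measurable f) {a b C : ℝ} (hC : ∀ y ∈ Ι a b, |f y| ≤ C) :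
    IntervalIntegrable f volume a b :=
  (intervalIntegrable_const (c := C)).mono_fun' hf.aestronglyMeasurable
    ((ae_restrict_iff' measurableSet_uIoc).2 (ae_of_all _ fun y hy ↦ by
      show ‖f y‖ ≤ C
      rw [Real.norm_eq_abs]; exact hC y hy))

/-- `ρ̃` is measurable. [folklore] -/
theorem measurable_rhoTilde : Measurable rhoTilde := by
  unfold rhoTilde
  exact (measurable_id.pow_const _).mul ((measurable_const.sub measurable_id).pow_const _)

/-- `ρ̃` is bounded on `[a, b] ⊂ (0, 1)`. [folklore] -/
theorem exists_bound_rhoTilde {a b : ℝ} (ha : 0 < a) (hb : b < 1) : ∃ R, 0 ≤ R ∧ ∀ y ∈ Icc a b, |rhoTilde y| ≤ R := by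
  have hcont : ContinuousOn rhoTilde (Icc a b) := by
    intro x hx
    unfold rhoTilde
    exact ((continuousAt_id.rpow_const (Or.inl (by linarith [hx.1] : (x:ℝ) ≠ 0))).mul
      ((continuousAt_const.sub continuousAt_id).rpow_const (Or.inl (by linarith [hx.2] : (1:ℝ) - x ≠ 0)))).continuousWithinAt
  obtain ⟨R, hR⟩ := (isCompact_Icc (a := a) (b := b)).exists_bound_of_continuousOn hcont
  exact ⟨max R 0, le_max_right _ _, fun y hy ↦ ((Real.norm_eq_abs _).symm.le.trans (hR y hy)).trans (le_max_left _ _)⟩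

namespace TestIntervals

variable (D : TestIntervals)

/-- **The trace density `π ρ̃ m` is bounded.** [folklore] -/
theorem exists_bound_traceDensity : ∃ C, 0 ≤ C ∧ ∀ y, |π * rhoTilde y * D.m y| ≤ C := by
  set lo := min D.α D.γ with hlo
  set hi := max D.β D.δ with hhi
  have hlo0 : 0 < lo := lt_min D.hα D.hγ
  have hhi1 : hi < 1 := max_lt D.hβ D.hδ
  obtain ⟨R, hR0, hR⟩ := exists_bound_rhoTilde hlo0 hhi1
  have hba : 0 < D.β - D.α := by linarith [D.hαβ]
  have hdg : 0 < D.δ - D.γ := by linarith [D.hγδ]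
  refine ⟨π * R * (1 / (D.β - D.α) + 1 / (D.δ - D.γ)), by positivity, fun y ↦ ?_⟩
  by_cases hy : y ∈ Icc lo hi
  · rw [abs_mul, abs_mul, abs_of_pos Real.pi_pos]
    exact mul_le_mul (mul_le_mul_of_nonneg_left (hR y hy) Real.pi_pos.le) (D.abs_m_le y) (abs_nonneg _)
      (mul_nonneg Real.pi_pos.le hR0)
  · have : D.m y = 0 := by
      apply D.m_eq_zero_of_not_mem
      simp only [mem_Icc, not_and_or, not_le] at hy
      rcases hy with h | h
      · exact Or.inl h.le
      · exact Or.inr h.le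
    rw [this, mul_zero, abs_zero]; positivity

/-- Auxiliary statement (`measurable_traceDensity`). [folklore] -/
theorem measurable_traceDensity : Measurable fun y ↦ π * rhoTilde y * D.m y :=
  (measurable_const.mul measurable_rhoTilde).mul D.measurable_m

end TestIntervals

/-! ### The identification theorem -/

section Identify

variable {Ω : Type*} [MeasurableSpace Ω] {P : Measure Ω} [IsProbabilityMeasure P] {S : Ω → ℝ}

/-- The discrepancy `Λ(y) = ρ̃(y)(P(scRatio y < S) − 1 + scRatio y)` (clamped versions). [folklore] -/
def discrep (P : Measure Ω) (S : Ω → ℝ) (y : ℝ) : ℝ := rhoTilde y * (survY P S y - (1 - scRatioC y))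

/-- Auxiliary statement (`measurable_discrep`). [folklore] -/
theorem measurable_discrep (hS : Measurable S) : Measurable (discrep P S) :=
  measurable_rhoTilde.mul ((measurable_survY hS).sub (measurable_const.sub measurable_scRatioC))

/-- `Λ` is bounded on `[a, b] ⊂ (0, 1)`. [folklore] -/
theorem exists_bound_discrep {a b : ℝ} (ha : 0 < a) (hb : b < 1) :
    ∃ C, ∀ y ∈ Icc a b, |discrep P S y| ≤ C := by
  obtain ⟨R, hR0, hR⟩ := exists_bound_rhoTilde ha hb
  refine ⟨R * 3, fun y hy ↦ ?_⟩
  rw [discrep, abs_mul]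
  refine mul_le_mul (hR y hy) ?_ (abs_nonneg _) hR0
  have h1 := survT_nonneg (P := P) (S := S) (scRatioC y)
  have h2 := survT_le_one (P := P) (S := S) (scRatioC y)
  have h3 := scRatioC_mem y
  rw [survY, abs_le]; constructor <;> linarith [h3.1, h3.2]

/-- **`Λ` is right-continuous on `(0, 1)`.** [folklore] -/
theorem continuousWithinAt_discrep (hS : Measurable S) {y : ℝ} (hy : y ∈ Ioo (0:ℝ) 1) :
    ContinuousWithinAt (discrep P S) (Ici y) y := by
  have hρ : ContinuousAt rhoTilde y :=
    (continuousOn_rhoTilde y hy).continuousAt (isOpen_Ioo.mem_nhds hy)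
  unfold discrep
  exact hρ.continuousWithinAt.mul ((continuousWithinAt_survY hS y).sub
    (continuousWithinAt_const.sub continuous_scRatioC.continuousWithinAt))

/-- From the test identities: `∫₀¹ m Λ = 0` for every pair of test intervals. [folklore] -/
theorem integral_m_mul_discrep_eq_zero (hS : Measurable S)
    (h1 : ∀ D : TestIntervals, ∫ y in (0:ℝ)..1, π * rhoTilde y * D.m y * survY P S y
      = ∫ y in (0:ℝ)..1, π * rhoTilde y * D.m y * (1 - scRatio y)) (D : TestIntervals) :
    ∫ y in (0:ℝ)..1, D.m y * discrep P S y = 0 := by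
  obtain ⟨C, hC0, hC⟩ := D.exists_bound_traceDensity
  have hmeas := D.measurable_traceDensity
  have hint1 : IntervalIntegrable (fun y ↦ π * rhoTilde y * D.m y * survY P S y) volume 0 1 := by
    refine intervalIntegrable_of_bounded (f := fun y ↦ π * rhoTilde y * D.m y * survY P S y)
      (hmeas.mul (measurable_survY hS)) (C := C) (fun y ↦ ?_) 0 1
    rw [abs_mul]
    have h1 := survT_nonneg (P := P) (S := S) (scRatioC y)
    have h2 := survT_le_one (P := P) (S := S) (scRatioC y)
    calc |π * rhoTilde y * D.m y| * |survY P S y| ≤ C * 1 :=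
          mul_le_mul (hC y) (by rw [survY, abs_le]; constructor <;> linarith) (abs_nonneg _) hC0
      _ = C := mul_one C
  have hint2 : IntervalIntegrable (fun y ↦ π * rhoTilde y * D.m y * (1 - scRatioC y)) volume 0 1 := by
    refine intervalIntegrable_of_bounded (f := fun y ↦ π * rhoTilde y * D.m y * (1 - scRatioC y))
      (hmeas.mul (measurable_const.sub measurable_scRatioC)) (C := C) (fun y ↦ ?_) 0 1
    rw [abs_mul]
    have h3 := scRatioC_mem y
    calc |π * rhoTilde y * D.m y| * |1 - scRatioC y| ≤ C * 1 :=
          mul_le_mul (hC y) (by rw [abs_le]; constructor <;> linarith [h3.1, h3.2]) (abs_nonneg _) hC0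
      _ = C := mul_one C
  have h1' : ∫ y in (0:ℝ)..1, π * rhoTilde y * D.m y * (1 - scRatio y)
      = ∫ y in (0:ℝ)..1, π * rhoTilde y * D.m y * (1 - scRatioC y) :=
    intervalIntegral.integral_congr fun y hy ↦ by
      rw [uIcc_of_le zero_le_one] at hy
      rw [scRatioC_eq hy]
  have hsub := intervalIntegral.integral_sub hint1 hint2
  rw [← h1', ← h1 D, sub_self] at hsub
  have hfun : (fun y ↦ D.m y * discrep P S y) = fun y ↦ π⁻¹ * (π * rhoTilde y * D.m y * survY P S y
      - π * rhoTilde y * D.m y * (1 - scRatioC y)) := by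
    funext y; rw [discrep]; field_simp
  have key : ∫ y in (0:ℝ)..1, D.m y * discrep P S y = π⁻¹ * ∫ y in (0:ℝ)..1, (π * rhoTilde y * D.m y * survY P S y
      - π * rhoTilde y * D.m y * (1 - scRatioC y)) := by
    rw [hfun, intervalIntegral.integral_const_mul]
  rw [key, hsub, mul_zero]

/-- Auxiliary statement (`intervalIntegrable_indicator_mul_discrep`). [folklore] -/
theorem intervalIntegrable_indicator_mul_discrep (hS : Measurable S) {a b : ℝ} (ha : 0 < a) (_hab : a ≤ b) (hb : b < 1)
    (c u v : ℝ) : IntervalIntegrable (fun y ↦ (Ioo a b).indicator (fun _ ↦ c) y * discrep P S y) volume u v := by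
  obtain ⟨C, hC⟩ := exists_bound_discrep (P := P) (S := S) ha hb
  refine intervalIntegrable_of_bounded (f := fun y ↦ (Ioo a b).indicator (fun _ ↦ c) y * discrep P S y)
    ((measurable_const.indicator measurableSet_Ioo).mul (measurable_discrep hS))
    (C := |c| * max C 0) (fun y ↦ ?_) u v
  by_cases hy : y ∈ Ioo a b
  · rw [indicator_of_mem hy, abs_mul]
    exact mul_le_mul_of_nonneg_left ((hC y ⟨hy.1.le, hy.2.le⟩).trans (le_max_left _ _)) (abs_nonneg _)
  · rw [indicator_of_notMem hy, zero_mul, abs_zero]; positivity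

/-- **Equality of interval averages of `Λ`.** [folklore] -/
theorem avg_discrep_eq (hS : Measurable S)
    (h1 : ∀ D : TestIntervals, ∫ y in (0:ℝ)..1, π * rhoTilde y * D.m y * survY P S y
      = ∫ y in (0:ℝ)..1, π * rhoTilde y * D.m y * (1 - scRatio y))
    {a b c d : ℝ} (ha : 0 < a) (hab : a < b) (hb : b < 1) (hc : 0 < c) (hcd : c < d) (hd : d < 1) :
    (1 / (b - a)) * ∫ y in a..b, discrep P S y = (1 / (d - c)) * ∫ y in c..d, discrep P S y := by
  set D : TestIntervals := ⟨a, b, c, d, ha, hab, hb, hc, hcd, hd⟩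
  have h := integral_m_mul_discrep_eq_zero hS h1 D
  have hsplit : ∀ y, D.m y * discrep P S y = (Ioo a b).indicator (fun _ ↦ 1 / (b - a)) y * discrep P S y
      - (Ioo c d).indicator (fun _ ↦ 1 / (d - c)) y * discrep P S y := by
    intro y; simp only [TestIntervals.m, D]; ring
  simp_rw [hsplit] at h
  rw [intervalIntegral.integral_sub (intervalIntegrable_indicator_mul_discrep hS ha hab.le hb _ 0 1)
    (intervalIntegrable_indicator_mul_discrep hS hc hcd.le hd _ 0 1),
    integral_indicator_Ioo_mul ha.le hab.le hb.le, integral_indicator_Ioo_mul hc.le hcd.le hd.le] at h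
  linarith

/-- **`Λ` is constant on `(0,1)`** (right-continuity and the right derivative of the primitive).
[folklore] -/
theorem discrep_eq_const (hS : Measurable S)
    (h1 : ∀ D : TestIntervals, ∫ y in (0:ℝ)..1, π * rhoTilde y * D.m y * survY P S y
      = ∫ y in (0:ℝ)..1, π * rhoTilde y * D.m y * (1 - scRatio y))
    {y₀ : ℝ} (hy₀ : y₀ ∈ Ioo (0:ℝ) 1) :
    discrep P S y₀ = (1 / (1 / 2 - 1 / 4)) * ∫ y in (1 / 4 : ℝ)..(1 / 2), discrep P S y := by
  set K : ℝ := (1 / (1 / 2 - 1 / 4)) * ∫ y in (1 / 4 : ℝ)..(1 / 2), discrep P S y with hK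
  -- the primitive from `y₀` is `K (u - y₀)` on `[y₀, 1)`
  have hprim : ∀ u ∈ Ico y₀ 1, ∫ y in y₀..u, discrep P S y = K * (u - y₀) := by
    intro u hu
    rcases hu.1.eq_or_lt with h | h
    · rw [← h]; simp
    · have havg := avg_discrep_eq hS h1 (c := 1 / 4) (d := 1 / 2) hy₀.1 h hu.2 (by norm_num) (by norm_num) (by norm_num)
      rw [← hK] at havg
      have hne : u - y₀ ≠ 0 := by linarith
      field_simp at havg
      linarith
  -- right derivative of the primitive at `y₀` is `Λ(y₀)` (FTC) and also `K`
  have hint : IntervalIntegrable (discrep P S) volume y₀ y₀ := IntervalIntegrable.refl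
  have hmeas : StronglyMeasurableAtFilter (discrep P S) (𝓝[>] y₀) volume :=
    (measurable_discrep hS).stronglyMeasurable.stronglyMeasurableAtFilter
  have hcont : ContinuousWithinAt (discrep P S) (Ioi y₀) y₀ :=
    (continuousWithinAt_discrep hS hy₀).mono Ioi_subset_Ici_self
  have hFTC : HasDerivWithinAt (fun u ↦ ∫ y in y₀..u, discrep P S y) (discrep P S y₀) (Ici y₀) y₀ :=
    intervalIntegral.integral_hasDerivWithinAt_right hint hmeas hcont
  have hlin : HasDerivWithinAt (fun u ↦ K * (u - y₀)) K (Ici y₀) y₀ := by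
    have := ((hasDerivAt_id y₀).sub_const y₀).const_mul K
    simp only [mul_one] at this
    exact this.hasDerivWithinAt
  have hlin' : HasDerivWithinAt (fun u ↦ ∫ y in y₀..u, discrep P S y) K (Ici y₀) y₀ := by
    refine hlin.congr_of_eventuallyEq ?_ (by simp)
    have : Ico y₀ 1 ∈ 𝓝[Ici y₀] y₀ := Ico_mem_nhdsGE hy₀.2
    filter_upwards [this] with u hu
    exact hprim u hu
  exact (uniqueDiffWithinAt_Ici y₀).eq_deriv _ hFTC hlin'

/-- `κ(y) = y^{1/3}(1−y)^{1/3} = 1/ρ̃(y)`, positive on `(0,1)` and at most `1`. [folklore] -/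
theorem rhoTilde_mul_kappa {y : ℝ} (hy : y ∈ Ioo (0:ℝ) 1) :
    rhoTilde y * (y ^ (1 / 3 : ℝ) * (1 - y) ^ (1 / 3 : ℝ)) = 1 := by
  rw [rhoTilde, Real.rpow_neg hy.1.le, Real.rpow_neg (by linarith [hy.2])]
  have h1 : 0 < y ^ (1 / 3 : ℝ) := Real.rpow_pos_of_pos hy.1 _
  have h2 : 0 < (1 - y) ^ (1 / 3 : ℝ) := Real.rpow_pos_of_pos (by linarith [hy.2]) _
  field_simp

/-- Auxiliary statement (`kappa_le_one`). [folklore] -/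
theorem kappa_le_one {y : ℝ} (hy : y ∈ Ioo (0:ℝ) 1) : y ^ (1 / 3 : ℝ) * (1 - y) ^ (1 / 3 : ℝ) ≤ 1 := by
  have h1 : y ^ (1 / 3 : ℝ) ≤ 1 := Real.rpow_le_one hy.1.le hy.2.le (by norm_num)
  have h2 : (1 - y) ^ (1 / 3 : ℝ) ≤ 1 := Real.rpow_le_one (by linarith [hy.2]) (by linarith [hy.1]) (by norm_num)
  have h3 : 0 ≤ y ^ (1 / 3 : ℝ) := Real.rpow_nonneg hy.1.le _
  nlinarith [Real.rpow_nonneg (by linarith [hy.2] : (0:ℝ) ≤ 1 - y) (1 / 3 : ℝ)]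

/-- **The layer-cake formula** `E[S] = ∫₀¹ P(t < S) dt` for `S ∈ [0, 1]`. [folklore] -/
theorem integral_eq_integral_survT (hS : Measurable S) (hS01 : ∀ ω, S ω ∈ Icc (0:ℝ) 1) :
    ∫ ω, S ω ∂P = ∫ t in (0:ℝ)..1, survT P S t := by
  have hint : Integrable S P := Integrable.of_bound hS.aestronglyMeasurable 1 (ae_of_all _ fun ω ↦ by
    rw [Real.norm_eq_abs, abs_le]; constructor <;> linarith [(hS01 ω).1, (hS01 ω).2])
  rw [hint.integral_eq_integral_meas_lt (ae_of_all _ fun ω ↦ (hS01 ω).1)]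
  -- beyond `1` the survival function vanishes
  have hsplit : ∫ t in Ioi (0:ℝ), P.real {a | t < S a} = ∫ t in Ioc (0:ℝ) 1, P.real {a | t < S a} := by
    rw [← Ioc_union_Ioi_eq_Ioi zero_le_one, setIntegral_union (Ioc_disjoint_Ioi le_rfl) measurableSet_Ioi]
    · have : ∫ t in Ioi (1:ℝ), P.real {a | t < S a} = 0 := by
        refine setIntegral_eq_zero_of_forall_eq_zero fun t ht ↦ ?_
        have : {a | t < S a} = ∅ := by
          ext a; simp only [mem_setOf_eq, mem_empty_iff_false, iff_false, not_lt]
          exact (hS01 a).2.trans (le_of_lt ht)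
        rw [this, measureReal_empty]
      rw [this, add_zero]
    · exact (intervalIntegrable_of_bounded (measurable_survT hS) (C := 1) (fun t ↦ by
        rw [abs_of_nonneg (survT_nonneg t)]; exact survT_le_one t) 0 1).def'.mono_set
        (by rw [uIoc_of_le zero_le_one])
    · refine integrableOn_zero.congr_fun (fun t ht ↦ ?_) measurableSet_Ioi
      have : {a | t < S a} = ∅ := by
        ext a; simp only [mem_setOf_eq, mem_empty_iff_false, iff_false, not_lt]
        exact (hS01 a).2.trans (le_of_lt ht)
      show (0:ℝ) = P.real {a | t < S a}
      rw [this, measureReal_empty]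
  rw [hsplit, intervalIntegral.integral_of_le zero_le_one]
  rfl

/-- **The constant is zero**: if `Λ ≡ K` on `(0,1)` and `E[S] = 1/2` then `K = 0`. [folklore] -/
theorem const_eq_zero (hS : Measurable S) (hS01 : ∀ ω, S ω ∈ Icc (0:ℝ) 1) {K : ℝ}
    (hK : ∀ y ∈ Ioo (0:ℝ) 1, discrep P S y = K) (h2 : ∫ ω, S ω ∂P = 1 / 2) : K = 0 := by
  by_contra hK0
  -- `survT t = 1 - t + K κ̃(t)` on `(0,1)` with `κ̃ > 0`
  set kt : ℝ → ℝ := fun t ↦ (survT P S t - (1 - t)) / K with hkt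
  have hkt_pos : ∀ t ∈ Ioo (0:ℝ) 1, 0 < kt t ∧ kt t ≤ 1 := by
    intro t ht
    set y := scRatioInv t with hy
    have hy01 : y ∈ Ioo (0:ℝ) 1 := scRatioInv_mem_Ioo ht
    have hty : scRatio y = t := scRatio_scRatioInv ⟨ht.1.le, ht.2.le⟩
    have hΛ := hK y hy01
    rw [discrep, survY, scRatioC_eq ⟨hy01.1.le, hy01.2.le⟩, hty] at hΛ
    -- `ρ̃ y (survT t - (1 - t)) = K` hence `kt t = 1/ρ̃ y = κ(y)`
    have hρκ := rhoTilde_mul_kappa hy01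
    have hρpos := rhoTilde_pos hy01
    have e1 : survT P S t - (1 - t) = K / rhoTilde y := by
      rw [eq_div_iff hρpos.ne']
      linarith [hΛ, mul_comm (rhoTilde y) (survT P S t - (1 - t))]
    have e2 : y ^ (1 / 3 : ℝ) * (1 - y) ^ (1 / 3 : ℝ) = 1 / rhoTilde y := by
      rw [eq_div_iff hρpos.ne']
      linarith [hρκ, mul_comm (rhoTilde y) (y ^ (1 / 3 : ℝ) * (1 - y) ^ (1 / 3 : ℝ))]
    have hkt_eq : kt t = y ^ (1 / 3 : ℝ) * (1 - y) ^ (1 / 3 : ℝ) := by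
      rw [hkt]; simp only
      rw [e1, e2]
      field_simp
    rw [hkt_eq]
    exact ⟨mul_pos (Real.rpow_pos_of_pos hy01.1 _) (Real.rpow_pos_of_pos (by linarith [hy01.2]) _), kappa_le_one hy01⟩
  have hmeas_kt : Measurable kt := ((measurable_survT hS).sub (measurable_const.sub measurable_id)).div_const K
  -- integrate the identity `survT t = (1 - t) + K kt t` over `(0,1)`
  have hlayer := integral_eq_integral_survT (P := P) hS hS01
  rw [h2] at hlayer
  have hint_kt : IntervalIntegrable kt volume 0 1 := by
    refine intervalIntegrable_of_bounded_on hmeas_kt (C := 2 / |K|) fun t ht ↦ ?_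
    rw [uIoc_of_le zero_le_one] at ht
    rw [hkt]; simp only [abs_div]
    apply div_le_div_of_nonneg_right _ (abs_nonneg K)
    have h1 := survT_nonneg (P := P) (S := S) t
    have h2 := survT_le_one (P := P) (S := S) t
    rw [abs_le]; constructor <;> linarith [ht.1, ht.2]
  have hdecomp : ∫ t in (0:ℝ)..1, survT P S t = (∫ t in (0:ℝ)..1, (1 - t)) + K * ∫ t in (0:ℝ)..1, kt t := by
    rw [← intervalIntegral.integral_const_mul, ← intervalIntegral.integral_add]
    · refine intervalIntegral.integral_congr fun t _ ↦ ?_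
      simp only [hkt]; field_simp; ring
    · exact (continuous_const.sub continuous_id).intervalIntegrable 0 1
    · exact hint_kt.const_mul K
  have hhalf : ∫ t in (0:ℝ)..1, (1 - t) = 1 / 2 := by
    rw [intervalIntegral.integral_sub intervalIntegrable_const intervalIntegral.intervalIntegrable_id]
    simp; norm_num
  have hpos : 0 < ∫ t in (0:ℝ)..1, kt t :=
    intervalIntegral.intervalIntegral_pos_of_pos_on hint_kt (fun t ht ↦ (hkt_pos t ht).1) zero_lt_one
  rw [hdecomp, hhalf] at hlayer
  have : K * ∫ t in (0:ℝ)..1, kt t = 0 := by linarith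
  rcases mul_eq_zero.1 this with h | h
  · exact hK0 h
  · linarith

/-- The distribution function of the uniform law on `[0, 1]`. [folklore] -/
theorem cdf_uniform (t : ℝ) :
    cdf (volume.restrict (Icc (0:ℝ) 1)) t = max 0 (min 1 t) := by
  haveI : IsProbabilityMeasure (volume.restrict (Icc (0:ℝ) 1)) := ⟨by simp⟩
  rw [cdf_eq_real, measureReal_restrict_apply measurableSet_Iic]
  rcases lt_or_ge t 0 with ht | ht
  · have : Iic t ∩ Icc (0:ℝ) 1 = ∅ := by
      ext x; simp only [mem_inter_iff, mem_Iic, mem_Icc, mem_empty_iff_false, iff_false, not_and, not_le]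
      intro hx h0; linarith
    rw [this, measureReal_empty, min_eq_right (by linarith), max_eq_left ht.le]
  rcases le_or_gt t 1 with ht1 | ht1
  · have : Iic t ∩ Icc (0:ℝ) 1 = Icc 0 t := by
      ext x; simp only [mem_inter_iff, mem_Iic, mem_Icc]
      constructor
      · rintro ⟨h1, h2, _⟩; exact ⟨h2, h1⟩
      · rintro ⟨h1, h2⟩; exact ⟨h2, h1, h2.trans ht1⟩
    rw [this, Real.volume_real_Icc_of_le ht, sub_zero, min_eq_right ht1, max_eq_right ht]
  · have : Iic t ∩ Icc (0:ℝ) 1 = Icc 0 1 := by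
      ext x; simp only [mem_inter_iff, mem_Iic, mem_Icc]
      constructor
      · rintro ⟨_, h2, h3⟩; exact ⟨h2, h3⟩
      · rintro ⟨h1, h2⟩; exact ⟨h2.trans ht1.le, h1, h2⟩
    rw [this, Real.volume_real_Icc_of_le zero_le_one, sub_zero, min_eq_left ht1.le, max_eq_right zero_le_one]

/-- **Identification of the uniform law on `[0, 1]`** from the test identities and the mean.
[folklore] -/
theorem map_eq_uniform_of_test_identities (hS : Measurable S) (hS01 : ∀ ω, S ω ∈ Icc (0:ℝ) 1)
    (h1 : ∀ D : TestIntervals, ∫ y in (0:ℝ)..1, π * rhoTilde y * D.m y * survY P S y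
      = ∫ y in (0:ℝ)..1, π * rhoTilde y * D.m y * (1 - scRatio y))
    (h2 : ∫ ω, S ω ∂P = 1 / 2) :
    P.map S = volume.restrict (Icc (0:ℝ) 1) := by
  haveI : IsProbabilityMeasure (P.map S) := Measure.isProbabilityMeasure_map hS.aemeasurable
  haveI : IsProbabilityMeasure (volume.restrict (Icc (0:ℝ) 1)) := ⟨by simp⟩
  -- `Λ ≡ K` and `K = 0`
  set K : ℝ := (1 / (1 / 2 - 1 / 4)) * ∫ y in (1 / 4 : ℝ)..(1 / 2), discrep P S y with hK
  have hΛ : ∀ y ∈ Ioo (0:ℝ) 1, discrep P S y = K := fun y hy ↦ discrep_eq_const hS h1 hy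
  have hK0 : K = 0 := const_eq_zero hS hS01 hΛ h2
  -- the survival function on `(0, 1)`
  have hsurv : ∀ t ∈ Ioo (0:ℝ) 1, survT P S t = 1 - t := by
    intro t ht
    set y := scRatioInv t with hy
    have hy01 : y ∈ Ioo (0:ℝ) 1 := scRatioInv_mem_Ioo ht
    have hty : scRatio y = t := scRatio_scRatioInv ⟨ht.1.le, ht.2.le⟩
    have h := hΛ y hy01
    rw [hK0, discrep, survY, scRatioC_eq ⟨hy01.1.le, hy01.2.le⟩, hty] at h
    rcases mul_eq_zero.1 h with h | h
    · exact absurd h (rhoTilde_pos hy01).ne'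
    · linarith
  -- compare distribution functions
  apply Measure.eq_of_cdf
  have hcdf : ∀ t ∈ Ioo (0:ℝ) 1, cdf (P.map S) t = t := by
    intro t ht
    have := survT_eq (P := P) hS t
    rw [hsurv t ht] at this
    linarith
  ext t
  rw [cdf_uniform]
  rcases lt_or_ge t 0 with ht | ht
  · rw [min_eq_right (by linarith), max_eq_left ht.le, cdf_eq_real, map_measureReal_apply hS measurableSet_Iic]
    have : S ⁻¹' Iic t = ∅ := by
      ext ω; simp only [mem_preimage, mem_Iic, mem_empty_iff_false, iff_false, not_le]
      exact ht.trans_le (hS01 ω).1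
    rw [this, measureReal_empty]
  rcases le_or_gt 1 t with ht1 | ht1
  · rw [min_eq_left ht1, max_eq_right zero_le_one, cdf_eq_real, map_measureReal_apply hS measurableSet_Iic]
    have : S ⁻¹' Iic t = univ := by
      ext ω; simp only [mem_preimage, mem_Iic, mem_univ, iff_true]
      exact (hS01 ω).2.trans ht1
    rw [this, probReal_univ]
  rcases ht.lt_or_eq with ht0 | ht0
  · rw [hcdf t ⟨ht0, ht1⟩, min_eq_right ht1.le, max_eq_right ht]
  · -- `t = 0`: right-continuity of the distribution function
    subst ht0
    rw [min_eq_right (zero_le_one), max_self]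
    have hrc := (cdf (P.map S)).right_continuous (0:ℝ)
    have hlim : Tendsto (cdf (P.map S)) (𝓝[>] (0:ℝ)) (𝓝 (cdf (P.map S) 0)) :=
      hrc.tendsto.mono_left (nhdsWithin_mono _ Ioi_subset_Ici_self)
    have hlim' : Tendsto (cdf (P.map S)) (𝓝[>] (0:ℝ)) (𝓝 0) := by
      have hid : Tendsto (fun t : ℝ ↦ t) (𝓝[>] (0:ℝ)) (𝓝 0) := tendsto_nhdsWithin_of_tendsto_nhds tendsto_id
      refine hid.congr' ?_
      filter_upwards [Ioo_mem_nhdsGT (zero_lt_one' ℝ)] with t ht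
      exact (hcdf t ht).symm
    exact tendsto_nhds_unique hlim hlim'

/-! ### The Fubini step: expectations of indicator traces -/

/-- **Expectation of the indicator trace**:
`E[∫₀¹ 𝟙{y < scRatioInv S} f(y) dy] = ∫₀¹ f(y) P(scRatio y < S) dy` for bounded measurable `f`.
[folklore] -/
theorem integral_integral_indicator_eq (hS : Measurable S) (hS01 : ∀ ω, S ω ∈ Icc (0:ℝ) 1) {f : ℝ → ℝ}
    (hf : Measurable f) {C : ℝ} (hfC : ∀ y, |f y| ≤ C) :
    ∫ ω, (∫ y in (0:ℝ)..1, (Iio (scRatioInv (S ω))).indicator f y) ∂P = ∫ y in (0:ℝ)..1, f y * survY P S y := by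
  -- rewrite the indicator through the event `{scRatioC y < S}`
  have hind : ∀ ω, ∀ y ∈ Ioc (0:ℝ) 1, (Iio (scRatioInv (S ω))).indicator f y
      = f y * ({p : Ω × ℝ | scRatioC p.2 < S p.1}.indicator (fun _ ↦ (1:ℝ)) (ω, y)) := by
    intro ω y hy
    have hy' : y ∈ Icc (0:ℝ) 1 := ⟨hy.1.le, hy.2⟩
    by_cases h : y < scRatioInv (S ω)
    · have hmem : (ω, y) ∈ {p : Ω × ℝ | scRatioC p.2 < S p.1} := by
        show scRatioC y < S ω
        rw [scRatioC_eq hy']; exact (lt_scRatioInv_iff hy' (hS01 ω)).1 h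
      rw [Set.indicator_of_mem (show y ∈ Iio (scRatioInv (S ω)) from h), Set.indicator_of_mem hmem, mul_one]
    · have hnmem : (ω, y) ∉ {p : Ω × ℝ | scRatioC p.2 < S p.1} := by
        show ¬ scRatioC y < S ω
        rw [scRatioC_eq hy']; exact fun h' ↦ h ((lt_scRatioInv_iff hy' (hS01 ω)).2 h')
      rw [Set.indicator_of_notMem (show y ∉ Iio (scRatioInv (S ω)) from h), Set.indicator_of_notMem hnmem, mul_zero]
  set g : Ω → ℝ → ℝ := fun ω y ↦ f y * ({p : Ω × ℝ | scRatioC p.2 < S p.1}.indicator (fun _ ↦ (1:ℝ)) (ω, y)) with hg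
  have hmeasSet : MeasurableSet {p : Ω × ℝ | scRatioC p.2 < S p.1} :=
    measurableSet_lt (measurable_scRatioC.comp measurable_snd) (hS.comp measurable_fst)
  have hgmeas : Measurable (Function.uncurry g) := by
    refine (hf.comp measurable_snd).mul ((measurable_const.indicator hmeasSet).comp measurable_id)
  have hgint : Integrable (Function.uncurry g) (P.prod (volume.restrict (Ioc (0:ℝ) 1))) := by
    refine Integrable.of_bound hgmeas.aestronglyMeasurable C (ae_of_all _ fun p ↦ ?_)
    simp only [Function.uncurry, hg, Real.norm_eq_abs, abs_mul]
    calc |f p.2| * |({p : Ω × ℝ | scRatioC p.2 < S p.1}.indicator (fun _ ↦ (1:ℝ)) (p.1, p.2))| ≤ C * 1 := by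
          refine mul_le_mul (hfC p.2) ?_ (abs_nonneg _) ((abs_nonneg _).trans (hfC p.2))
          by_cases h : (p.1, p.2) ∈ {p : Ω × ℝ | scRatioC p.2 < S p.1}
          · rw [indicator_of_mem h, abs_one]
          · rw [indicator_of_notMem h, abs_zero]; exact zero_le_one
      _ = C := mul_one C
  have h1 : ∫ ω, (∫ y in (0:ℝ)..1, (Iio (scRatioInv (S ω))).indicator f y) ∂P = ∫ ω, (∫ y in Ioc (0:ℝ) 1, g ω y) ∂P := by
    refine integral_congr_ae (ae_of_all _ fun ω ↦ ?_)
    show ∫ y in (0:ℝ)..1, (Iio (scRatioInv (S ω))).indicator f y = ∫ y in Ioc (0:ℝ) 1, g ω y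
    rw [intervalIntegral.integral_of_le zero_le_one]
    exact setIntegral_congr_fun measurableSet_Ioc fun y hy ↦ hind ω y hy
  rw [h1, integral_integral_swap hgint, intervalIntegral.integral_of_le zero_le_one]
  refine setIntegral_congr_fun measurableSet_Ioc fun y _ ↦ ?_
  rw [hg]
  simp only
  rw [MeasureTheory.integral_const_mul]
  congr 1
  have : (fun ω ↦ ({p : Ω × ℝ | scRatioC p.2 < S p.1}.indicator (fun _ ↦ (1:ℝ)) (ω, y)))
      = {ω | scRatioC y < S ω}.indicator fun _ ↦ (1:ℝ) := by
    funext ω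
    by_cases h : scRatioC y < S ω
    · rw [Set.indicator_of_mem (show (ω, y) ∈ {p : Ω × ℝ | scRatioC p.2 < S p.1} from h),
        Set.indicator_of_mem (show ω ∈ {ω | scRatioC y < S ω} from h)]
    · rw [Set.indicator_of_notMem (show (ω, y) ∉ {p : Ω × ℝ | scRatioC p.2 < S p.1} from h),
        Set.indicator_of_notMem (show ω ∉ {ω | scRatioC y < S ω} from h)]
  rw [this, integral_indicator_const _ (measurableSet_lt measurable_const hS), smul_eq_mul, mul_one]
  rfl

end Identify

end Literature.Probability.RandomPlanarGeometry
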